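import Mathlib
import Summits.NavierStokesRegularity.NavierStokesRegularity.Theorems.ThreadingFluxHorizonTowerDefs
import Summits.NavierStokesRegularity.NavierStokesRegularity.Theorems.ThreadingFluxHorizonTowerFirstLemmas
import HarnessLib

/-!
# Crux `PoloidalLiouville` (stmt-NavierStokesRegularity-1222, wall W1), crux idea «horizon-threading-tower» (ns-idea-15):
# the (S) statements `HeadVirialIdentity` and `OrderOneFluxIdentity` of the Defs file BY NAME

Support file (Theorems-side glue; seat ns-wall-eng-7 g4, cell ns-wall-extremal, W1 adjunct; `--supports
stmt-NavierStokesRegularity-1222 --as helper`).  ARM A's `ThreadingFluxHorizonTowerFirstLemmas.lean` (p661847) proves the BODIES of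
the sketch's `HeadVirialIdentity` / `OrderOneFluxIdentity` verbatim (it predates the Theorems-side Defs file); this file states them
BY NAME against `ThreadingFluxHorizonTowerDefs.lean` (l.103 `HeadVirialIdentity`, l.111 `OrderOneFluxIdentity`), so that every
(S)-class statement of the Defs file is citable by name:

* `HorizonTower.headVirialIdentity_holds : HeadVirialIdentity` — for `ω ∈ C¹` tangent to the spheres about `x₀` and divergence free and
  `B ∈ C²`, `⟪y, curl(∇B × ω)⟫ = ⟪ω, ∇(radialVirial B x₀)⟫` (`radialVirial B x₀ y = ⟪y − x₀, ∇B⟫` unfolds definitionally);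
* `HorizonTower.orderOneFluxIdentity_holds : OrderOneFluxIdentity` — for an unthreaded `C²` slice, `⟪y, curl(u × curl u)⟫ = ⟪curl u, ∇⟪u, y⟫⟫`.

HONEST LABEL: pure vector calculus about typed objects of one crux idea; `PoloidalLiouville` (1222), `UnthreadedRigidity` (27585) and NS
regularity remain OPEN and untouched; information-grade for W1/W2 (movement 0).  [cite: MajdaBertozziCUP2002, §1.1 (vector identities)]
-/

-- the summit and its single problem share the name (D-0017 nested layout)
set_option linter.dupNamespace false

noncomputable section

namespace Summit.NavierStokesRegularity.NavierStokesRegularity.Theorems.PoloidalLiouville.HorizonTower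

/-- ★ **`HeadVirialIdentity` BY NAME** (Defs l.103): for `ω ∈ C¹` tangent to the spheres about `x₀` and divergence free, and any `C²`
scalar `B`, `⟪y, curl(∇B × ω)⟫ = ⟪ω, ∇((y·∇)B)⟫` — from ARM A's `headVirialIdentity` (p661847; `radialVirial` unfolds by `rfl`). -/
theorem headVirialIdentity_holds : HeadVirialIdentity :=
  fun ω B x₀ hω hB htan hdiv x => headVirialIdentity ω B x₀ hω hB htan hdiv x

/-- ★ **`OrderOneFluxIdentity` BY NAME** (Defs l.111): for an unthreaded `C²` slice, `⟪y, curl(u × ω)⟫ = ⟪ω, ∇m⟫`, `ω = curl u`,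
`m = ⟪u, y⟫` — from ARM A's `orderOneFluxIdentity` (p661847). -/
theorem orderOneFluxIdentity_holds : OrderOneFluxIdentity :=
  fun u x₀ hu htan x => orderOneFluxIdentity u x₀ hu htan x

end Summit.NavierStokesRegularity.NavierStokesRegularity.Theorems.PoloidalLiouville.HorizonTower

end
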